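import Summits.Ventures.QEC.Census.CertBZPlaneCount
import Summits.Ventures.QEC.Census.CertBZChunks
import Summits.Ventures.QEC.Census.CertPopcount
import HarnessLib

/-!
# Lane-parallel replay of a Brouwer–Zimmermann matrix — soundness IV: assembly into the tree's `Reaches …`
# (conclusion = `Reaches (bzLeaf wmax allow) (rowPos G 0) t 0 0` verbatim, hence `matrixEnumOK` / `bzZEnum` through
# `Census/CertBZChunks.lean: matrixEnumOK_of_reaches` / `DistCert.bzZEnum_of_reaches`; theorems only)

* Word facts in the tree's vocabulary: `popc_succ_high`, `length_filter_range_testBit` (column count = `popc n`),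
  `exists_map_of_sublist_rowPos`, `xorFst_map_pair`, `xorSnd_map_pair`; the converse weight test
  `wtGt_of_lt_popc` is qec-search-10's (`Census/CertPopcount.lean`).
* `laneSel_eq_laneMem` / `laneMem_eq_map` / `laneSel_eq_of_covers` — a lane whose indicator bits spell the index list
  `J` decodes to EXACTLY `(xorFst S, xorSnd S)` of the position sublist `S = J.map (j ↦ (2^j, G[j]))` of `rowPos G 0`.
* `reaches_of_segOK` / `reaches_of_segList` — ASSEMBLY: rows below `2^n` + passing segments covering `[0,|G|)` ⇒
  `Reaches (bzLeaf wmax allow) (rowPos G 0) t 0 0`.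
* (Control: the Steane matrix verdict re-derived through the lane engine elaborates — see the scratch file in the
  type-01 session folder; not restated here since `bzZEnum_certSteane7_chunked` already states it.)

USE (emitted certificate modules): per matrix `G = giRows Gb mt` (a literal or `rfl`), one
`theorem seg_k : segOK n wmax allow G t m₀ s fuel = true := by decide +kernel` per segment (≤ ≈ 8·10⁶ lanes each;
`set_option maxHeartbeats 400000000 in` as in `CertCheckBZFast`), then
`matrixEnumOK_of_reaches G hG (reaches_of_segList n wmax allow G t fuel hrows segs (by decide) hsegs)` or
`DistCert.bzZEnum_of_reaches`. Measured: `[[144,12,12]]` bz_aut block 0 (both matrices, 1.6·10⁷ selections) in 67 s.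
Axioms standard.
-/

namespace Summit.Ventures.QEC.Census.Plane

open List

/-! ## Word facts in the tree's vocabulary (`wtGt`, `popc`, `rowPos`) -/

/-- `popc` peels the top bit: `popc (n+1) c = popc n c + bit n`. -/
theorem popc_succ_high : ∀ (n c : ℕ), popc (n + 1) c = popc n c + (c.testBit n).toNat
  | 0, c => by
    rw [popc, popc, popc, Nat.testBit_zero]
    rcases Nat.mod_two_eq_zero_or_one c with h | h <;> simp [h]
  | n + 1, c => by
    rw [popc, popc_succ_high n (c / 2), popc, Nat.testBit_succ, Nat.add_assoc]

/-- **Counting the set bits below `n` column by column gives `popc`.** -/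
theorem length_filter_range_testBit (c : ℕ) : ∀ n, ((List.range n).filter fun q => c.testBit q).length = popc n c
  | 0 => by simp [popc]
  | n + 1 => by
    rw [List.range_succ, List.filter_append, List.length_append, length_filter_range_testBit c n,
      popc_succ_high, List.filter_singleton]
    cases c.testBit n <;> simp

/-- A sublist of the row-position list is the position list of a sub-sequence of row indices. -/
theorem exists_map_of_sublist_rowPos (G : List ℕ) {S : List (ℕ × ℕ)} (h : S.Sublist (rowPos G 0)) :
    ∃ J : List ℕ, J.Sublist (List.range G.length) ∧ S = J.map fun j => (2 ^ j, G.getD j 0) := by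
  rw [rowPos_zero] at h
  exact List.sublist_map_iff.1 h

/-- Selection word of an index-position list. -/
theorem xorFst_map_pair (G : List ℕ) (J : List ℕ) :
    xorFst (J.map fun j => (2 ^ j, G.getD j 0)) = xorList (J.map fun j => 2 ^ j) := by
  rw [xorFst, List.map_map]; rfl

/-- Codeword of an index-position list. -/
theorem xorSnd_map_pair (G : List ℕ) (J : List ℕ) :
    xorSnd (J.map fun j => (2 ^ j, G.getD j 0)) = xorList (J.map fun j => G.getD j 0) := by
  rw [xorSnd, List.map_map]; rfl

/-! ## Lanes decode to selections -/

/-- `laneSel` folds exactly the member list `laneMem`: selection word `u ⊕ ⊕ 2^j`, codeword `c ⊕ ⊕ G[j]`. -/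
theorem laneSel_eq_laneMem (b : ℕ) : ∀ (gs xs : List ℕ) (j u c : ℕ),
    laneSel b gs xs j u c =
      (u ^^^ xorList ((laneMem b gs xs j).map fun p => 2 ^ p.1), c ^^^ xorList ((laneMem b gs xs j).map Prod.snd))
  | [], xs, j, u, c => by cases xs <;> simp [laneSel, laneMem, xorList]
  | g :: gs, [], j, u, c => by simp [laneSel, laneMem, xorList]
  | g :: gs, x :: xs, j, u, c => by
    rw [laneSel, laneMem, bitAt_eq]
    cases x.testBit b
    · simp only [cond_false]
      exact laneSel_eq_laneMem b gs xs (j + 1) u c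
    · simp only [cond_true, List.map_cons, xorList]
      rw [laneSel_eq_laneMem b gs xs (j + 1), natXor_eq, natXor_eq, pow_eq, Nat.xor_assoc, Nat.xor_assoc]

/-- **A lane whose indicator bits spell `J` has member list `J`** (with the rows of `G`): if bit `b` of `χ_i` is
`[j₀ + i ∈ J]` for all `i`, `J` is strictly increasing and `J ⊆ [j₀, j₀ + |G|)`, then
`laneMem b G χ j₀ = J.map (j ↦ (j, G[j − j₀]))`. -/
theorem laneMem_eq_map (b : ℕ) : ∀ (gs xs : List ℕ) (j0 : ℕ) (J : List ℕ), J.Pairwise (· < ·) →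
    (∀ i, (xs.getD i 0).testBit b = decide (j0 + i ∈ J)) → (∀ i ∈ J, j0 ≤ i ∧ i < j0 + gs.length) →
    laneMem b gs xs j0 = J.map fun i => (i, gs.getD (i - j0) 0)
  | [], xs, j0, J, _, _, hlt => by
    have : J = [] := List.eq_nil_iff_forall_not_mem.2 fun i hi => by have := hlt i hi; simp at this; omega
    subst this
    cases xs <;> rfl
  | g :: gs, [], j0, J, _, hX, hlt => by
    have : J = [] := List.eq_nil_iff_forall_not_mem.2 fun i hi => by
      have h1 := hX (i - j0)
      have h2 := hlt i hi
      rw [show j0 + (i - j0) = i by omega] at h1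
      simp [hi] at h1
    subst this
    rfl
  | g :: gs, x :: xs, j0, J, hJ, hX, hlt => by
    rw [laneMem]
    have hx : x.testBit b = decide (j0 ∈ J) := by simpa using hX 0
    have hX' : ∀ (J' : List ℕ), (∀ i, j0 + 1 + i ∈ J' ↔ j0 + (i + 1) ∈ J) →
        ∀ i, (xs.getD i 0).testBit b = decide (j0 + 1 + i ∈ J') := fun J' hJ' i => by
      rw [← List.getD_cons_succ (x := x), hX (i + 1)]
      simp only [hJ' i]
    by_cases hj : j0 ∈ J
    · -- the head of `J` is `j0`
      obtain ⟨J', rfl⟩ : ∃ J', J = j0 :: J' := by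
        cases J with
        | nil => simp at hj
        | cons a J' =>
          rcases List.mem_cons.1 hj with h | h
          · exact ⟨J', by rw [h]⟩
          · exfalso
            have h1 := (List.pairwise_cons.1 hJ).1 j0 h
            have h2 := (hlt a List.mem_cons_self).1
            omega
      have hJ' := (List.pairwise_cons.1 hJ)
      rw [hx, decide_eq_true hj, cond_true, List.map_cons, Nat.sub_self, List.getD_cons_zero]
      congr 1
      rw [laneMem_eq_map b gs xs (j0 + 1) J' hJ'.2 (hX' J' fun i => ?_) fun i hi => ?_]
      · refine List.map_congr_left fun i hi => ?_
        have : j0 + 1 ≤ i := hJ'.1 i hi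
        rw [show i - j0 = (i - (j0 + 1)) + 1 by omega, List.getD_cons_succ]
      · rw [show j0 + (i + 1) = j0 + 1 + i by omega, List.mem_cons]
        have : j0 + 1 + i ≠ j0 := by omega
        simp [this]
      · have h1 := hJ'.1 i hi
        have h2 := (hlt i (List.mem_cons_of_mem _ hi)).2
        simp only [List.length_cons] at h2
        omega
    · -- `j0 ∉ J`: skip this row
      rw [hx, decide_eq_false hj, cond_false,
        laneMem_eq_map b gs xs (j0 + 1) J hJ (hX' J fun i => by rw [show j0 + (i + 1) = j0 + 1 + i by omega])
          fun i hi => ?_]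
      · refine List.map_congr_left fun i hi => ?_
        have : j0 + 1 ≤ i := by
          have := (hlt i hi).1
          rcases this.eq_or_lt with h | h
          · exact absurd (h ▸ hi) hj
          · omega
        rw [show i - j0 = (i - (j0 + 1)) + 1 by omega, List.getD_cons_succ]
      · have h1 := hlt i hi
        simp only [List.length_cons] at h1
        have : i ≠ j0 := fun e => hj (e ▸ hi)
        omega

/-- **Decoded lane = the sublist's words**: if lane `b` spells the index list `J ⊆ [0,|G|)` (strictly increasing),
then `laneSel` returns exactly the selection word and the codeword of the position sublist of `J`. -/
theorem laneSel_eq_of_covers (b : ℕ) (G X : List ℕ) (J : List ℕ) (hJ : J.Pairwise (· < ·))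
    (hX : ∀ i, (X.getD i 0).testBit b = decide (i ∈ J)) (hlt : ∀ i ∈ J, i < G.length) :
    laneSel b G X 0 0 0 =
      (xorFst (J.map fun j => (2 ^ j, G.getD j 0)), xorSnd (J.map fun j => (2 ^ j, G.getD j 0))) := by
  rw [laneSel_eq_laneMem, laneMem_eq_map b G X 0 J hJ (fun i => by rw [Nat.zero_add]; exact hX i)
    (fun i hi => ⟨Nat.zero_le _, by rw [Nat.zero_add]; exact hlt i hi⟩), xorFst_map_pair, xorSnd_map_pair,
    List.map_map, List.map_map, Nat.zero_xor, Nat.zero_xor]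
  simp only [Function.comp_def, Nat.sub_zero]

/-! ## Assembly: segments covering `[0, |G|)` give `Reaches` -/

/-- **SOUNDNESS OF THE LANE-PARALLEL REPLAY.** Let the rows of `G` be words below `2^n`. If for every row index
`m < |G|` some segment `[m₀, m₀+s) ∋ m` passes `segOK n wmax allow G t m₀ s fuel`, then the leaf
`bzLeaf wmax allow` holds at every sub-selection of `≤ t` rows of `G` — `Reaches (bzLeaf wmax allow) (rowPos G 0) t 0 0`,
the tree's statement of a passing C4 replay (`Census/CertScan.lean`), from which
`Census/CertBZChunks.lean: matrixEnumOK_of_reaches` / `DistCert.bzZEnum_of_reaches` give `matrixEnumOK … = true` /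
`c.bzZEnum z b i = true` verbatim. -/
theorem reaches_of_segOK (n wmax : ℕ) (allow G : List ℕ) (t fuel : ℕ) (hG : ∀ g ∈ G, g < 2 ^ n)
    (hcov : ∀ m, m < G.length → ∃ m0 s, m0 ≤ m ∧ m < m0 + s ∧ segOK n wmax allow G t m0 s fuel = true) :
    Reaches (bzLeaf wmax allow) (rowPos G 0) t 0 0 := by
  intro S hS hlen
  rw [Nat.zero_xor, Nat.zero_xor]
  obtain ⟨J, hJsub, rfl⟩ := exists_map_of_sublist_rowPos G hS
  have hJp : J.Pairwise (· < ·) := List.Pairwise.sublist hJsub List.pairwise_lt_range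
  have hJlt : ∀ j ∈ J, j < G.length := fun j hj => List.mem_range.1 (hJsub.subset hj)
  rw [List.length_map] at hlen
  rcases List.eq_nil_or_concat J with rfl | ⟨J', m, rfl⟩
  · -- the empty selection
    simp [xorFst, xorSnd, xorList, bzLeaf]
  · -- a selection with largest row `m`
    have hm : m < G.length := hJlt m (by simp)
    obtain ⟨m0, s, hm0, hms, hok⟩ := hcov m hm
    rw [List.concat_eq_append] at hJp hJlt hlen ⊢
    have hJ'p : J'.Pairwise (· < ·) := (List.pairwise_append.1 hJp).1
    have hJ'm : ∀ j ∈ J', j < m := fun j hj => (List.pairwise_append.1 hJp).2.2 j hj m (List.mem_singleton_self m)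
    have hJ'l : J'.length ≤ t - 1 := by rw [List.length_append, List.length_singleton] at hlen; omega
    obtain ⟨b, hb, hbits⟩ := covers_segment t m0 s hm0 hms J' hJ'p hJ'm hJ'l
    rw [segOK] at hok
    have hsel := laneSel_eq_of_covers b G (segment t m0 s).2 (J' ++ [m]) hJp hbits hJlt
    rcases familyOK_sound (Nat.succ_pos wmax) hok b hb with hcnt | hleaf
    · -- at least `wmax + 1` set bits among the columns `0 … n-1`: the fast weight test fires
      rw [hsel] at hcnt
      simp only at hcnt
      rw [length_filter_range_testBit] at hcnt
      have hclt : xorSnd ((J' ++ [m]).map fun j => (2 ^ j, G.getD j 0)) < 2 ^ n := by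
        rw [xorSnd_map_pair]
        refine xorList_lt n _ fun x hx => ?_
        obtain ⟨j, hj, rfl⟩ := List.mem_map.1 hx
        have hjl := hJlt j hj
        rw [List.getD_eq_getElem?_getD, List.getElem?_eq_getElem hjl, Option.getD_some]
        exact hG _ (List.getElem_mem hjl)
      have hwt := wtGt_of_lt_popc n wmax _ hclt (by omega)
      rw [bzLeaf, hwt]
      simp only [Bool.or_true, Bool.true_or]
    · -- a straggler: the tree's leaf was evaluated on exactly this selection
      rw [hsel] at hleaf
      exact hleaf

/-- All segments of a list pass. (Each should be its own `decide +kernel` theorem; this bundles their statements.) -/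
theorem reaches_of_segList (n wmax : ℕ) (allow G : List ℕ) (t fuel : ℕ) (hG : ∀ g ∈ G, g < 2 ^ n)
    (segs : List (ℕ × ℕ))
    (hcov : ((List.range G.length).all fun m => segs.any fun p => decide (p.1 ≤ m) && decide (m < p.1 + p.2)) = true)
    (hok : ∀ p ∈ segs, segOK n wmax allow G t p.1 p.2 fuel = true) :
    Reaches (bzLeaf wmax allow) (rowPos G 0) t 0 0 := by
  refine reaches_of_segOK n wmax allow G t fuel hG fun m hm => ?_
  simp only [List.all_eq_true, List.mem_range, List.any_eq_true, Bool.and_eq_true, decide_eq_true_eq] at hcov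
  obtain ⟨p, hp, h1, h2⟩ := hcov m hm
  exact ⟨p.1, p.2, h1, h2, hok p hp⟩

end Summit.Ventures.QEC.Census.Plane

/-! ## Appended 2026-08-27: the `X`-side monolithic wrapper (the `Z` side's is `CertBZChunks.DistCert.bzZEnum_of_reaches`) -/

namespace Summit.Ventures.QEC.Census.DistCert

variable (c : DistCert) (z : BZData)

/-- `X` side, monolithic `Reaches` form (roles exchanged: stabilizers `HX`, rank certificate `rcX`, generators `LX`,
threshold `dX − 1`, allow-list of `sideX`): a replay of matrix `i` of block `b` established as ONE `Reaches` — e.g. by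
the lane engine's `Plane.reaches_of_segList` — gives the tree's verdict `c.bzXEnum z b i = true`. -/
theorem bzXEnum_of_reaches {b i : ℕ} {blk : BZBlock} {mt : BZMatrix}
    (hb : z.sideX.blocks[b]? = some blk) (hi : blk.mats[i]? = some mt)
    (G : List ℕ) (hG : giRows (gbRows c.HX z.rcX z.LX blk) mt = G)
    (w : ℕ) (hw : c.dX - 1 = w) (allow : List ℕ) (hallow : c.sideX.found.map Prod.fst = allow)
    (h : Reaches (bzLeaf w allow) (rowPos G 0) mt.t 0 0) : c.bzXEnum z b i = true := by
  simp only [bzXEnum, hb, hi]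
  rw [hw, hallow]
  exact matrixEnumOK_of_reaches G hG h

end Summit.Ventures.QEC.Census.DistCert
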